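/-
Copyright (c) 2026. Released under Apache 2.0 license.
-/
import Summits.RiemannHypothesis.RiemannHypothesis.Theorems.SemilocalCert554Data
import Summits.RiemannHypothesis.RiemannHypothesis.Theorems.SemilocalCert554DataPme6
import Literature.NumberTheory.LFunctions.WeilTwoPrimePos59Def
import Literature.NumberTheory.LFunctions.WeilBlockRowsPZ
import HarnessLib

/-!
# Semi-local threshold `a*({2})`, lower rung `b = 277/500`: dominance rows 74–74 of the parity-0 block

Cell `rh-explicit` (HOME `run/shared/lean/pub/rh-explicit/`), seat cc-s2-2, block C⁺/B2.  The one-prime Stage-C certificate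
`weilCert3S554 : WeilCert3` (`WeilFirstPrimeCertificateZ.lean`) at half-length `a₀ = b = 277/500 = 0.554`: cells = the 248 inner
first-prime cells of the tree's two-prime chain on `[0, 80]` (`cellsT80fp`, `SemilocalCert554Split.lean`; `prec = 120`,
`j = 5`), one-prime level `levelT80fp ≈ 2.70861`, `T = 80`, `N = 149`; Legendre blocks `C`, `D` (`nb = 75`) and the factored
inverse `Dn/Ls` of `weilCert23P` (even) / `weilCert23E` (odd) BY NAME (their `D C = I` and `Dn` claim rows transfer by
definitional unfolding); new: the moment table (`pnu = 64`, each entry from the two-prime chain's kernel-verified partial sums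
by `WeilCert3.checkNuAt_of_partsT80fp`), the materialized rounded moment blocks `P_r` (`WeilBlockRowsP.lean`), the Bessel
block claims `Hp = diag(2a₀/(2(2i+p)+1))`, the dyadic PSD factors `U`, and `κ`.  Generated by exact rational arithmetic
mirroring the checker (`λ_min(S'_even) ≈ 5.82·10⁻⁸`, `λ_min(S'_odd) ≈ 7.20·10⁻⁶`; exact one-sided dominance slack
`2.9·10⁻⁸` / `3.6·10⁻⁶`).  Nothing about the data is trusted: the bridge `le_weilSemilocalThreshold_two_of_check_of_le`
consumes only the kernel-evaluated Boolean `weilCert3S554.check = true`.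
`R = S'_0(κ) − UᵀU` row by row in the factored form `WeilCert.checkDomRowPZ` (materialized `P_r` block `cert554Pme`, factored inverse
`weilCert23PDne/weilCert23PLse` and Legendre block of `weilCert23P` by name, diagonal Bessel block `cert554Hpe`, `κ = cert554Kappa`), each row by
`decide +kernel` in its own declaration; assembled in `SemilocalCert554Block0.lean`. Pure proof file.
-/

set_option linter.dupNamespace false  -- the mandated namespace repeats `RiemannHypothesis`

noncomputable section

namespace Summit.RiemannHypothesis.RiemannHypothesis.Theorems.SemilocalCert554

open Literature.NumberTheory.LFunctions

set_option maxHeartbeats 0 in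
/-- Kernel check of the one-sided dominance of row 74 of `R = S' − UᵀU`, parity 0, certificate `weilCert3S554` (factored form). [folklore] -/
theorem checkDomRowPZ0_74_cert554 :
    weilCert3S554.base.checkDomRowPZ cert554Pme weilCert23PDne weilCert23PLse cert554Hpe cert554Kappa 0 74 = true := by
  decide +kernel

end Summit.RiemannHypothesis.RiemannHypothesis.Theorems.SemilocalCert554

end
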